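import Summits.RiemannHypothesis.RiemannHypothesis.Theorems.Splittings.BombieriTruncOffLineSparse

/-!
# Splittings — x-wuc (xiv-d3): class indicators, ON-LINE helper slots, the SYNTHESIS VECTOR and the ON-LINE HELPER SCREENING THEOREM (T7a)

Cell rh-split, seat rh-split-x-wuc g6/g7 (brief sha16 f79c5f09d8bcb036), card `run/shared/lean/pub/rh-split/cards/SPLIT-x-wuc.md`
§12–§13 (scratch of record `HOME/rh-split-x-wuc/SplitXWucG7b.lean` sha16 d0583c86bc2d8ec7: farm `lean check` rc 0 · 0 sorry · 0 warning,
standard axioms; referee replays: see the card).  Carved VERBATIM from that scratch by `HOME/rh-split-x-wuc/cut7/make_cut7.py`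
(cut (xiv-d), deltas listed in `cut7/CUT7.md`); sections as numbered there.
* G7.1 `indVec`, on-line slots and their pairing calculus (an on-line class is self-mirror); G7.2 `helperVec`, `synthVec j₀ S f a`, its pairing
  `−2m + Σ_i |a_i|²/m_{f i}` and **(T7a) `synth_negRoot`**: `cost + c·Σ|a_i|² < 2cm ⟹ 𝒦_{[−1,1]}(Γ_N)` has a real eigenvalue in `(−c,0)`
  (UNCONDITIONAL); G7.3 the DEMODULATED synthesis formula `‖F(synthVec)(u)‖ = ‖2m·sinh(κu) − Σ_i a_i e^{−i(t_i−τ)u}‖` and the scaled cost identity.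
HONEST LABEL: «SPLITTING SEARCH over kernel-typed RH-EQUIVALENCES; a splitting A ∧ B ⟹ RH is CONDITIONAL bookkeeping
unless A and B are both proved; nothing here bears on the truth of RH.»
-/

set_option linter.dupNamespace false

noncomputable section

open scoped Classical ComplexConjugate
open Set Filter Topology Complex MeasureTheory

namespace Summit.RiemannHypothesis.RiemannHypothesis.Theorems.Splittings.BombieriTruncSynthesis

open Literature.NumberTheory.LFunctions Literature.NumberTheory.LFunctions.Bombieri2000
open Summit.RiemannHypothesis.RiemannHypothesis.Theses.RuelleBand
open Summit.RiemannHypothesis.RiemannHypothesis.Theorems.Splittings.BombieriTruncEigen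
open Summit.RiemannHypothesis.RiemannHypothesis.Theorems.Splittings.BombieriFozNoDep
open Summit.RiemannHypothesis.RiemannHypothesis.Theorems.Splittings.BombieriTruncGram
open Summit.RiemannHypothesis.RiemannHypothesis.Theorems.Splittings.BombieriTruncPairing
open Summit.RiemannHypothesis.RiemannHypothesis.Theorems.Splittings.BombieriTruncScreening
open Summit.RiemannHypothesis.RiemannHypothesis.Theorems.Splittings.BombieriTruncBandGap
open Summit.RiemannHypothesis.RiemannHypothesis.Theorems.Splittings.BombieriTruncMultiplicity
open Summit.RiemannHypothesis.RiemannHypothesis.Theorems.Splittings.BombieriTruncEventualStrip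
open Summit.RiemannHypothesis.RiemannHypothesis.Theorems.Splittings.BombieriTruncExactness
open Summit.RiemannHypothesis.RiemannHypothesis.Theorems.Splittings.BombieriTruncClump
open Summit.RiemannHypothesis.RiemannHypothesis.Theorems.Splittings.BombieriTruncOffLineSparse

variable {N : ℕ}

/-! ### G7.1 Class indicators and ON-LINE slots -/

/-- The indicator of the multiplicity class of the slot `k` (for an ON-LINE zero this is the whole `pairing`-class: `1 − ρ̄ = ρ`). -/
def indVec (k : truncIdx N) : truncIdx N → ℂ := fun s ↦ if s ∈ fib k then 1 else 0

/-- A class indicator lies in the class-constant subspace `classSub N`. -/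
theorem indVec_mem (k : truncIdx N) : indVec k ∈ classSub N := by
  intro s s' h
  have h1 : s ∈ fib k ↔ s' ∈ fib k := by rw [mem_fib, mem_fib, h]
  simp only [indVec, h1]

/-- `F` of the class indicator of `k` is `#fib k · e^{−iγ_k u}`. -/
theorem F_indVec (k : truncIdx N) (u : ℝ) :
    F N (indVec k) u = ((fib k).card : ℂ) * cexp (-(I * (k : ZeroIdx).gamma * u)) := by
  unfold F indVec
  exact sum_ite_fib_mul_exp k u

/-- On-line slots have `Re ρ = ½`. -/
theorem re_of_not_offLine {i : ZeroIdx} (h : ¬ i.OffLine) : i.val.re = 1 / 2 := not_ne_iff.1 h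

/-- Slots in the fibre of an ON-LINE slot are on-line. -/
theorem not_offLine_of_mem_fib {k s : truncIdx N} (hk : ¬ (k : ZeroIdx).OffLine) (hs : s ∈ fib k) :
    ¬ (s : ZeroIdx).OffLine := by
  intro h
  apply h
  rw [mem_fib.1 hs]
  exact re_of_not_offLine hk

/-- `I·γ = (Re ρ − ½) + i·Im ρ`. -/
theorem I_mul_gamma_eq (i : ZeroIdx) :
    I * i.gamma = ((i.val.re - 1 / 2 : ℝ) : ℂ) + I * (i.val.im : ℂ) := by
  rw [I_mul_gamma]
  apply Complex.ext <;> simp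

/-- For an ON-LINE slot `I·γ = i·Im ρ`. -/
theorem I_mul_gamma_onLine {i : ZeroIdx} (h : ¬ i.OffLine) : I * i.gamma = I * (i.val.im : ℂ) := by
  rw [I_mul_gamma_eq, re_of_not_offLine h]
  simp

/-- An on-line class indicator pairs with itself to the multiplicity `m_k` (on-line classes are self-mirror). -/
theorem pairing_indVec_self {k : truncIdx N} (hk : ¬ (k : ZeroIdx).OffLine) :
    pairing N (indVec k) (indVec k) = (fib k).card := by
  unfold pairing
  have h : ∀ s : truncIdx N, conj (indVec k s) * indVec k (tbar s) = if s ∈ fib k then 1 else 0 := by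
    intro s
    by_cases hs : s ∈ fib k
    · have ht : tbar s = s := tbar_eq_self (not_offLine_of_mem_fib hk hs)
      simp [indVec, hs, ht]
    · simp [indVec, hs]
  rw [Finset.sum_congr rfl fun s _ ↦ h s, Finset.sum_ite_mem, Finset.univ_inter, Finset.sum_const, nsmul_eq_mul,
    mul_one]

/-- Indicators of DIFFERENT on-line classes are pairing-orthogonal. -/
theorem pairing_indVec_indVec_eq_zero {k l : truncIdx N} (hk : ¬ (k : ZeroIdx).OffLine)
    (hne : (k : ZeroIdx).val ≠ (l : ZeroIdx).val) : pairing N (indVec k) (indVec l) = 0 := by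
  unfold pairing
  refine Finset.sum_eq_zero fun s _ ↦ ?_
  by_cases hs : s ∈ fib k
  · have ht : tbar s = s := tbar_eq_self (not_offLine_of_mem_fib hk hs)
    have hl : s ∉ fib l := fun h ↦ hne ((mem_fib.1 hs).symm.trans (mem_fib.1 h))
    simp [indVec, ht, hl]
  · simp [indVec, hs]

/-- An off-line class vector and an on-line class indicator are pairing-orthogonal. -/
theorem pairing_classVec_indVec {j₀ k : truncIdx N} (hj : (j₀ : ZeroIdx).OffLine) (hk : ¬ (k : ZeroIdx).OffLine) :
    pairing N (classVec j₀) (indVec k) = 0 := by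
  unfold pairing
  refine Finset.sum_eq_zero fun s _ ↦ ?_
  by_cases ht : tbar s ∈ fib k
  · have hsre : (s : ZeroIdx).val.re = 1 / 2 := by
      have h1 := re_val_tbar s
      have h2 : ((tbar s : truncIdx N) : ZeroIdx).val.re = 1 / 2 := by
        rw [mem_fib.1 ht]; exact re_of_not_offLine hk
      linarith
    have h1 : s ∉ fib j₀ := fun h ↦ hj (by rw [← mem_fib.1 h]; exact hsre)
    have h2 : s ∉ fib (tbar j₀) := fun h ↦ by
      have h3 := re_val_tbar j₀
      have h4 : ((tbar j₀ : truncIdx N) : ZeroIdx).val.re = 1 / 2 := by rw [← mem_fib.1 h]; exact hsre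
      exact hj (by linarith)
    simp [classVec, h1, h2]
  · simp [indVec, ht]

/-- … and in the other order. -/
theorem pairing_indVec_classVec {j₀ k : truncIdx N} (hj : (j₀ : ZeroIdx).OffLine) (hk : ¬ (k : ZeroIdx).OffLine) :
    pairing N (indVec k) (classVec j₀) = 0 := by
  unfold pairing
  refine Finset.sum_eq_zero fun s _ ↦ ?_
  by_cases hs : s ∈ fib k
  · have ht : tbar s = s := tbar_eq_self (not_offLine_of_mem_fib hk hs)
    have hsre : (s : ZeroIdx).val.re = 1 / 2 := by rw [mem_fib.1 hs]; exact re_of_not_offLine hk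
    have h1 : s ∉ fib j₀ := fun h ↦ hj (by rw [← mem_fib.1 h]; exact hsre)
    have h2 : s ∉ fib (tbar j₀) := fun h ↦ by
      have h3 := re_val_tbar j₀
      have h4 : ((tbar j₀ : truncIdx N) : ZeroIdx).val.re = 1 / 2 := by rw [← mem_fib.1 h]; exact hsre
      exact hj (by linarith)
    simp [classVec, indVec, ht, h1, h2]
  · simp [indVec, hs]

/-- `pairing` is conjugate-linear in the first slot over finite sums … -/
theorem pairing_sum_smul_left {ι : Type*} (S : Finset ι) (c : ι → ℂ) (v : ι → truncIdx N → ℂ)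
    (y : truncIdx N → ℂ) :
    pairing N (∑ i ∈ S, c i • v i) y = ∑ i ∈ S, conj (c i) * pairing N (v i) y := by
  simp only [pairing, Finset.sum_apply, Pi.smul_apply, smul_eq_mul, map_sum, map_mul, Finset.sum_mul,
    Finset.mul_sum]
  rw [Finset.sum_comm]
  refine Finset.sum_congr rfl fun i _ ↦ Finset.sum_congr rfl fun s _ ↦ ?_
  ring

/-- … and linear in the second. -/
theorem pairing_sum_smul_right {ι : Type*} (S : Finset ι) (c : ι → ℂ) (v : ι → truncIdx N → ℂ)
    (x : truncIdx N → ℂ) :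
    pairing N x (∑ i ∈ S, c i • v i) = ∑ i ∈ S, c i * pairing N x (v i) := by
  simp only [pairing, Finset.sum_apply, Pi.smul_apply, smul_eq_mul, Finset.mul_sum]
  rw [Finset.sum_comm]
  refine Finset.sum_congr rfl fun i _ ↦ Finset.sum_congr rfl fun s _ ↦ ?_
  ring

/-- `F` is additive in the vector argument (pointwise form). -/
theorem F_add' (x y : truncIdx N → ℂ) (u : ℝ) : F N (x + y) u = F N x u + F N y u := by
  simp only [F, Pi.add_apply, add_mul, Finset.sum_add_distrib]

/-! ### G7.2 The synthesis vector (off-line target + ON-LINE helpers) and the helper screening theorem (T7a) -/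

/-- ON-LINE helper vector: amplitude `a_i` on the class of the slot `f i`, normalised by the class multiplicity. -/
def helperVec {ι : Type*} (S : Finset ι) (f : ι → truncIdx N) (a : ι → ℂ) : truncIdx N → ℂ :=
  ∑ i ∈ S, (a i / ((fib (f i)).card : ℂ)) • indVec (f i)

/-- The synthesis vector: class vector of the off-line target `j₀` plus on-line helpers. -/
def synthVec (j₀ : truncIdx N) {ι : Type*} (S : Finset ι) (f : ι → truncIdx N) (a : ι → ℂ) : truncIdx N → ℂ :=
  classVec j₀ + helperVec S f a

/-- The helper vector (a combination of class indicators) lies in `classSub N`. -/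
theorem helperVec_mem {ι : Type*} (S : Finset ι) (f : ι → truncIdx N) (a : ι → ℂ) : helperVec S f a ∈ classSub N :=
  Submodule.sum_mem _ fun i _ ↦ Submodule.smul_mem _ _ (indVec_mem (f i))

/-- The synthesis vector lies in `classSub N`. -/
theorem synthVec_mem (j₀ : truncIdx N) {ι : Type*} (S : Finset ι) (f : ι → truncIdx N) (a : ι → ℂ) :
    synthVec j₀ S f a ∈ classSub N :=
  Submodule.add_mem _ (classVec_mem j₀) (helperVec_mem S f a)

/-- `F` of the helper vector: `Σ_i a_i e^{−iγ_{f i} u}` (the class-size normalisation cancels). -/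
theorem F_helperVec {ι : Type*} (S : Finset ι) (f : ι → truncIdx N) (a : ι → ℂ) (u : ℝ) :
    F N (helperVec S f a) u = ∑ i ∈ S, a i * cexp (-(I * ((f i : truncIdx N) : ZeroIdx).gamma * u)) := by
  rw [helperVec, F_finset_sum]
  refine Finset.sum_congr rfl fun i _ ↦ ?_
  have h : ((fib (f i)).card : ℂ) ≠ 0 := Nat.cast_ne_zero.2 (fib_card_pos (f i)).ne'
  rw [F_indVec, ← mul_assoc, div_mul_cancel₀ (a i) h]

/-- The helpers pair to `Σ_i |a_i|² / m_{f i}` (distinct on-line classes are orthogonal, each is self-mirror). -/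
theorem pairing_helperVec {ι : Type*} (S : Finset ι) {f : ι → truncIdx N}
    (hon : ∀ i ∈ S, ¬ ((f i : truncIdx N) : ZeroIdx).OffLine)
    (hinj : ∀ i ∈ S, ∀ l ∈ S, ((f i : truncIdx N) : ZeroIdx).val = ((f l : truncIdx N) : ZeroIdx).val → i = l)
    (a : ι → ℂ) :
    pairing N (helperVec S f a) (helperVec S f a) = ((∑ i ∈ S, ‖a i‖ ^ 2 / ((fib (f i)).card : ℝ) : ℝ) : ℂ) := by
  rw [helperVec, pairing_finset_sum, Complex.ofReal_sum]
  refine Finset.sum_congr rfl fun i hi ↦ ?_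
  rw [Finset.sum_eq_single i (fun l hl hli ↦ ?_) (fun h ↦ absurd hi h)]
  · rw [pairing_indVec_self (hon i hi)]
    have h : ((fib (f i)).card : ℂ) ≠ 0 := Nat.cast_ne_zero.2 (fib_card_pos (f i)).ne'
    push_cast
    rw [map_div₀, Complex.conj_natCast, ← Complex.conj_mul']
    field_simp
  · rw [pairing_indVec_indVec_eq_zero (hon i hi) (fun h ↦ hli (hinj i hi l hl h).symm), mul_zero]

/-- The pairing of the synthesis vector: `−2m + Σ_i |a_i|²/m_{f i}` (cross terms vanish: on-line ≠ off-line classes). -/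
theorem re_pairing_synthVec {j₀ : truncIdx N} (hj : (j₀ : ZeroIdx).OffLine) {ι : Type*} (S : Finset ι)
    {f : ι → truncIdx N} (hon : ∀ i ∈ S, ¬ ((f i : truncIdx N) : ZeroIdx).OffLine)
    (hinj : ∀ i ∈ S, ∀ l ∈ S, ((f i : truncIdx N) : ZeroIdx).val = ((f l : truncIdx N) : ZeroIdx).val → i = l)
    (a : ι → ℂ) :
    (pairing N (synthVec j₀ S f a) (synthVec j₀ S f a)).re =
      -2 * (fib j₀).card + ∑ i ∈ S, ‖a i‖ ^ 2 / ((fib (f i)).card : ℝ) := by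
  have hcross1 : pairing N (classVec j₀) (helperVec S f a) = 0 := by
    rw [helperVec, pairing_sum_smul_right]
    exact Finset.sum_eq_zero fun i hi ↦ by rw [pairing_classVec_indVec hj (hon i hi), mul_zero]
  have hcross2 : pairing N (helperVec S f a) (classVec j₀) = 0 := by
    rw [helperVec, pairing_sum_smul_left]
    exact Finset.sum_eq_zero fun i hi ↦ by rw [pairing_indVec_classVec hj (hon i hi), mul_zero]
  rw [synthVec, pairing_add_left, pairing_add_right, pairing_add_right, hcross1, hcross2, pairing_classVec hj,
    pairing_helperVec S hon hinj a, add_zero, zero_add, Complex.add_re, Complex.ofReal_re]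
  simp

/-- **(T7a) ON-LINE HELPER SCREENING THEOREM** (kernel; unconditional).  Let `j₀ ∈ Γ_N` carry an OFF-LINE zero of class
multiplicity `m`, and let `f i` (`i ∈ S`) be slots carrying PAIRWISE DIFFERENT ON-LINE zeros, with amplitudes `a_i`.  If
`∫_{[−1,1]} |F(synthVec)(u)|² du + c·Σ_i |a_i|² < 2cm`, then `𝒦_{[−1,1]}(Γ_N)` has a real eigenvalue in `(−c, 0)`.
MECHANISM: the synthesis vector is class-constant, pairs to `−2m + Σ|a_i|²/m_{f i} ≤ −2m + Σ|a_i|²`, and (K2-mult) converts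
`cost < c·(−pairing)` into the eigenvalue.  No frame theory, no density, no simplicity, no named fact. [new] -/
theorem synth_negRoot {j₀ : truncIdx N} (hj : (j₀ : ZeroIdx).OffLine) {ι : Type*} (S : Finset ι)
    {f : ι → truncIdx N} (hon : ∀ i ∈ S, ¬ ((f i : truncIdx N) : ZeroIdx).OffLine)
    (hinj : ∀ i ∈ S, ∀ l ∈ S, ((f i : truncIdx N) : ZeroIdx).val = ((f l : truncIdx N) : ZeroIdx).val → i = l)
    (a : ι → ℂ) {c : ℝ} (hc : 0 < c)
    (h : (∫ u in Icc (-1 : ℝ) 1, ‖F N (synthVec j₀ S f a) u‖ ^ 2) + c * ∑ i ∈ S, ‖a i‖ ^ 2 <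
      2 * c * (fib j₀).card) :
    ∃ μ ∈ (truncKMat (Icc (-1 : ℝ) 1) N).charpoly.roots, μ.im = 0 ∧ -c < μ.re ∧ μ.re < 0 := by
  refine exists_negRoot_of_screening_mult one_pos hc (synthVec_mem j₀ S f a) ?_
  rw [re_pairing_synthVec hj S hon hinj a]
  have hle : ∑ i ∈ S, ‖a i‖ ^ 2 / ((fib (f i)).card : ℝ) ≤ ∑ i ∈ S, ‖a i‖ ^ 2 :=
    Finset.sum_le_sum fun i _ ↦ div_le_self (by positivity) (by exact_mod_cast fib_card_pos (f i))
  have hle' := mul_le_mul_of_nonneg_left hle hc.le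
  nlinarith

/-! ### G7.3 The demodulated synthesis formula -/

/-- `κ(j) := Re ρ_j − ½`. -/
def kap (j : truncIdx N) : ℝ := (j : ZeroIdx).val.re - 1 / 2

/-- `τ(j) := Im ρ_j`. -/
def tau (j : truncIdx N) : ℝ := (j : ZeroIdx).val.im

/-- `ρ_j − ½ = κ_j + i τ_j` with `κ_j = Re ρ_j − ½`, `τ_j = Im ρ_j`. -/
theorem val_sub_half (j : truncIdx N) : (j : ZeroIdx).val - 1 / 2 = (kap j : ℂ) + I * (tau j : ℂ) := by
  rw [← I_mul_gamma, I_mul_gamma_eq]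
  rfl

/-- **Demodulation.**  `F(synthVec)(u) = e^{−iτu} · ( m·(e^{−κu} − e^{κu}) + Σ_i a_i e^{−i(t_i − τ)u} )` for on-line helpers. -/
theorem F_synthVec {j₀ : truncIdx N} {ι : Type*} (S : Finset ι) {f : ι → truncIdx N}
    (hon : ∀ i ∈ S, ¬ ((f i : truncIdx N) : ZeroIdx).OffLine) (a : ι → ℂ) (u : ℝ) :
    F N (synthVec j₀ S f a) u =
      cexp (-(I * (tau j₀ : ℂ) * u)) *
        (((fib j₀).card : ℂ) * (cexp (-((kap j₀ : ℂ) * u)) - cexp ((kap j₀ : ℂ) * u)) +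
          ∑ i ∈ S, a i * cexp (-(I * ((tau (f i) - tau j₀ : ℝ) : ℂ) * u))) := by
  have e1 : cexp (-(((j₀ : ZeroIdx).val - 1 / 2) * u)) = cexp (-(I * (tau j₀ : ℂ) * u)) * cexp (-((kap j₀ : ℂ) * u)) := by
    rw [← Complex.exp_add, val_sub_half]
    congr 1
    ring
  have e2 : cexp (conj ((j₀ : ZeroIdx).val - 1 / 2) * u) = cexp (-(I * (tau j₀ : ℂ) * u)) * cexp ((kap j₀ : ℂ) * u) := by
    rw [← Complex.exp_add, val_sub_half]
    congr 1
    simp only [map_add, map_mul, Complex.conj_ofReal, Complex.conj_I]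
    ring
  have e3 : ∀ i ∈ S, cexp (-(I * ((f i : truncIdx N) : ZeroIdx).gamma * u)) =
      cexp (-(I * (tau j₀ : ℂ) * u)) * cexp (-(I * ((tau (f i) - tau j₀ : ℝ) : ℂ) * u)) := by
    intro i hi
    rw [← Complex.exp_add, I_mul_gamma_onLine (hon i hi)]
    congr 1
    simp only [tau]
    push_cast
    ring
  rw [synthVec, F_add', F_classVec, F_pairVec_eq, F_helperVec, e1, e2,
    Finset.sum_congr rfl fun i hi ↦ by rw [e3 i hi]]
  rw [mul_add, Finset.mul_sum]
  congr 1
  · ring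
  · refine Finset.sum_congr rfl fun i _ ↦ ?_
    ring

/-- **Demodulated norm.**  `‖F(synthVec)(u)‖ = ‖2m·sinh(κu) − Σ_i a_i e^{−i(t_i − τ)u}‖`. -/
theorem norm_F_synthVec {j₀ : truncIdx N} {ι : Type*} (S : Finset ι) {f : ι → truncIdx N}
    (hon : ∀ i ∈ S, ¬ ((f i : truncIdx N) : ZeroIdx).OffLine) (a : ι → ℂ) (u : ℝ) :
    ‖F N (synthVec j₀ S f a) u‖ =
      ‖2 * ((fib j₀).card : ℂ) * (Real.sinh (kap j₀ * u) : ℂ) -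
        ∑ i ∈ S, a i * cexp (-(I * ((tau (f i) - tau j₀ : ℝ) : ℂ) * u))‖ := by
  rw [F_synthVec S hon a u, norm_mul]
  have h1 : ‖cexp (-(I * (tau j₀ : ℂ) * u))‖ = 1 := by
    rw [show -(I * (tau j₀ : ℂ) * u) = ((-(tau j₀ * u) : ℝ) : ℂ) * I by push_cast; ring, Complex.norm_exp_ofReal_mul_I]
  rw [h1, one_mul, ← norm_neg]
  congr 1
  rw [Complex.ofReal_sinh, Complex.sinh]
  push_cast
  ring

/-- **Scaled cost identity.**  With amplitudes `a_i = m·b_i` the cost is `m² · ∫_{[−1,1]} |2 sinh(κu) − Σ b_i e^{−i(t_i−τ)u}|² du`. -/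
theorem cost_synthVec_scaled {j₀ : truncIdx N} {ι : Type*} (S : Finset ι) {f : ι → truncIdx N}
    (hon : ∀ i ∈ S, ¬ ((f i : truncIdx N) : ZeroIdx).OffLine) (b : ι → ℂ) :
    ∫ u in Icc (-1 : ℝ) 1, ‖F N (synthVec j₀ S f (fun i ↦ ((fib j₀).card : ℂ) * b i)) u‖ ^ 2 =
      ((fib j₀).card : ℝ) ^ 2 *
        ∫ u in Icc (-1 : ℝ) 1, ‖2 * (Real.sinh (kap j₀ * u) : ℂ) -
          ∑ i ∈ S, b i * cexp (-(I * ((tau (f i) - tau j₀ : ℝ) : ℂ) * u))‖ ^ 2 := by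
  rw [← integral_const_mul]
  refine setIntegral_congr_fun measurableSet_Icc fun u _ ↦ ?_
  rw [norm_F_synthVec S hon _ u]
  have h : 2 * ((fib j₀).card : ℂ) * (Real.sinh (kap j₀ * u) : ℂ) -
      ∑ i ∈ S, ((fib j₀).card : ℂ) * b i * cexp (-(I * ((tau (f i) - tau j₀ : ℝ) : ℂ) * u)) =
      ((fib j₀).card : ℂ) * (2 * (Real.sinh (kap j₀ * u) : ℂ) -
        ∑ i ∈ S, b i * cexp (-(I * ((tau (f i) - tau j₀ : ℝ) : ℂ) * u))) := by
    rw [mul_sub, Finset.mul_sum]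
    congr 1
    · ring
    · refine Finset.sum_congr rfl fun i _ ↦ ?_
      ring
  rw [h, norm_mul, Complex.norm_natCast, mul_pow]

end Summit.RiemannHypothesis.RiemannHypothesis.Theorems.Splittings.BombieriTruncSynthesis
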